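import Mathlib.LinearAlgebra.Projectivization.Action
import Mathlib.LinearAlgebra.Projectivization.Cardinality
import Mathlib.RepresentationTheory.Basic
import Mathlib.LinearAlgebra.Trace
import Mathlib.LinearAlgebra.PID
import Mathlib.LinearAlgebra.FiniteDimensional.Lemmas
import Mathlib.Algebra.GroupWithZero.Units.Fintype
import Mathlib.Topology.Instances.ZMod
import Mathlib.Topology.Instances.Matrix
import Literature.NumberTheory.GaloisRepresentations.GaloisRep
import HarnessLib

/-!
# The Steinberg–Artin representation `St_ℓ ∘ ρ̄`

For a prime `ℓ` and a continuous representation `ρ̄ : Γ → GL₂(𝔽_ℓ)` of a topological group `Γ`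
(typically `Γ = Γ_K`, an absolute Galois group) we construct the continuous representation
`St_ℓ ∘ ρ̄ : Γ → GL_ℓ(ℂ)`, where `St_ℓ` is the **Steinberg representation** of `GL₂(𝔽_ℓ)`: the
`ℓ`-dimensional complement of the trivial representation in the permutation representation
`ℂ[ℙ¹(𝔽_ℓ)]` (Fulton–Harris §5.2; Bump §4.1), realised here as the *augmentation submodule*
`{Σ c_L e_L : Σ c_L = 0} ⊂ ℂ[ℙ¹(𝔽_ℓ)]` in a chosen basis.  Its character is the Steinberg
character `g ↦ #{ρ̄(g)-stable lines in 𝔽_ℓ²} − 1` (values `ℓ, 0, 1, −1` on central,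
non-semisimple, split and non-split classes).

## Main definitions

* `permRep k G X` — the permutation representation of a `G`-set `X` on `X →₀ k`;
  `augmentation k X` — `ε : (X →₀ k) → k`, `Σ c_x e_x ↦ Σ c_x`;
  `augmentationSubmodule k X = ker ε`; `augmentationRep k G X` — the representation of `G` on it.
* `frameOfBasis τ b : G →* GL (Fin m) k` — matrices of a representation in a basis.
* `steinbergGL ℓ : GL (Fin 2) (ZMod ℓ) →* GL (Fin ℓ) ℂ` — the Steinberg representation of
  `GL₂(𝔽_ℓ)` in the basis `steinbergBasis ℓ` of the augmentation submodule of `ℂ[ℙ¹(𝔽_ℓ)]`.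
* `FramedRep.steinberg ℓ ρ : FramedRep Γ ℂ ℓ` — `St_ℓ ∘ ρ` for `ρ : FramedRep Γ (ZMod ℓ) 2`;
  `steinbergArtinRep ℓ ρ : FramedGaloisRep K ℂ ℓ` — the case `Γ = Γ_K` (the **Steinberg–Artin
  representation** attached to a mod-`ℓ` Galois representation `ρ̄ : Γ_K → GL₂(𝔽_ℓ)`).

## Main statements

* `trace_permRep` — the permutation character counts fixed points (Serre, Ex. 2.2);
  `trace_augmentationRep` — `tr (g | ker ε) = #Fix(g) − 1` when `#X` is invertible in `k`;
  `finrank_augmentationSubmodule` — `dim ker ε = #X − 1`.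
* `nat_card_eigenvectors_eq` — for `g ∈ GL_n(K)`, `K` a field:
  `#{w ≠ 0 : g w ∈ K w} = #{L ∈ ℙ(Kⁿ) : g L = L} · #Kˣ`.
* `trace_steinbergGL` — `tr St_ℓ(g) = #{g-stable lines} − 1`;
  `FramedRep.steinberg_trace`, `steinbergArtinRep_trace` — the Steinberg character of `St_ℓ ∘ ρ`
  in the form `#{w ≠ 0 eigenvector of ρ g} / (ℓ − 1) − 1` used by route
  `Summits/Langlands/Langlands/Theses/SteinbergArtin` (items `SteinbergArtinExists`,
  `SteinbergStrongArtin`); `steinbergArtin_exists` — the existence statement in that form.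

## References

* W. Fulton, J. Harris, *Representation Theory. A First Course* (GTM 129, 1991), §5.2,
  pp. 67–68: the permutation representation of `GL₂(𝔽_q)` on `ℙ¹(𝔽_q)` has dimension `q + 1`,
  contains the trivial representation, and the complement `V` has character `q, 0, 1, −1` on the
  classes `a_x, b_x, c_{x,y}, d_{x,y}`.
* D. Bump, *Automorphic Forms and Representations* (1997), §4.1, Thm. 4.1.1 and the paragraph
  following it: `B(1,1) = 1 ⊕ St`, "this `q`-dimensional representation is called the Steinberg
  representation".
* J.-P. Serre, *Linear Representations of Finite Groups* (GTM 42, 1977), §1.2 (c) (permutation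
  representations), §2.3 Ex. 2.2 (their character counts fixed points), Ex. 2.6 (a)
  (`ρ_X = 1 ⊕ θ`, `χ = 1 + ψ`).
-/

noncomputable section

open scoped LinearAlgebra.Projectivization Matrix

namespace Literature.NumberTheory.GaloisRepresentations

universe u

/-! ### The permutation representation of a `G`-set and its augmentation submodule -/

section Augmentation

variable (k : Type*) [CommRing k] (G : Type*) [Group G] (X : Type*) [MulAction G X]

/-- The **permutation representation** of `G` on the free `k`-module `X →₀ k` with basis
`(e_x)_{x ∈ X}` attached to a `G`-set `X`: `g · e_x = e_{g • x}` (`Finsupp.lmapDomain`; Mathlib's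
`Representation.ofMulAction` is the same action on the monoid-algebra carrier `k[X]`).
[cite: SerreLinearRepresentations1977, §1.2 example (c)] -/
def permRep : Representation k G (X →₀ k) where
  toFun g := Finsupp.lmapDomain k k (fun x : X => g • x)
  map_one' := by
    ext x
    simp
  map_mul' g h := by
    ext x
    simp [mul_smul]

variable {G X} in
/-- `g · e_x = e_{g • x}`. [folklore] -/
@[simp] lemma permRep_single (g : G) (x : X) (c : k) :
    permRep k G X g (Finsupp.single x c) = Finsupp.single (g • x) c := by
  simp [permRep]

/-- The **augmentation** `ε : (X →₀ k) → k`, `ε (Σ c_x e_x) = Σ c_x`. [folklore] -/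
def augmentation : (X →₀ k) →ₗ[k] k :=
  Finsupp.linearCombination k (fun _ : X => (1 : k))

variable {X} in
/-- `ε e_x = 1` (scaled). [folklore] -/
@[simp] lemma augmentation_single (x : X) (c : k) :
    augmentation k X (Finsupp.single x c) = c := by
  simp [augmentation]

variable {G X} in
/-- The augmentation is `G`-invariant: `ε (g · f) = ε f`. [folklore] -/
lemma augmentation_permRep (g : G) (f : X →₀ k) :
    augmentation k X (permRep k G X g f) = augmentation k X f := by
  induction f using Finsupp.induction_linear with
  | zero => simp
  | add f₁ f₂ h₁ h₂ => simp [map_add, h₁, h₂]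
  | single x c => simp

/-- The **augmentation submodule** `ker ε = {Σ c_x e_x : Σ c_x = 0}` of the permutation module of a
`G`-set `X` (a `G`-stable hyperplane when `X` is nonempty).
[cite: SerreLinearRepresentations1977, §2.3 Ex. 2.6 (a)] -/
def augmentationSubmodule : Submodule k (X →₀ k) :=
  LinearMap.ker (augmentation k X)

variable {X} in
/-- Membership in the augmentation submodule. [folklore] -/
lemma mem_augmentationSubmodule_iff (f : X →₀ k) :
    f ∈ augmentationSubmodule k X ↔ augmentation k X f = 0 :=
  LinearMap.mem_ker

variable {G X} in
/-- The augmentation submodule is `G`-stable. [folklore] -/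
lemma permRep_mem_augmentationSubmodule (g : G) {f : X →₀ k}
    (hf : f ∈ augmentationSubmodule k X) : permRep k G X g f ∈ augmentationSubmodule k X := by
  rw [mem_augmentationSubmodule_iff] at hf ⊢
  rw [augmentation_permRep, hf]

/-- The **augmentation representation** of the `G`-set `X`: the permutation representation
restricted to the `G`-stable submodule `ker ε`, so that `k[X] = 𝟙 ⊕ (ker ε)` when `#X` is
invertible in `k`.  For `G = GL₂(𝔽_q)` and `X = ℙ¹(𝔽_q)` this is the **Steinberg representation**
of dimension `q`. [cite: SerreLinearRepresentations1977, §2.3 Ex. 2.6 (a)]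
[cite: FultonHarrisGTM129, §5.2 pp. 67–68] -/
def augmentationRep : Representation k G (augmentationSubmodule k X) where
  toFun g := (permRep k G X g).restrict fun _ hf => permRep_mem_augmentationSubmodule k g hf
  map_one' := LinearMap.ext fun f => Subtype.ext (by simp)
  map_mul' g h := LinearMap.ext fun f => Subtype.ext (by simp)

variable {G X} in
/-- Unfolding lemma: the augmentation representation acts by the permutation action. [folklore] -/
@[simp] lemma coe_augmentationRep_apply (g : G) (f : augmentationSubmodule k X) :
    ((augmentationRep k G X g f : augmentationSubmodule k X) : X →₀ k) = permRep k G X g f := rfl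

variable {G X} in
/-- **The permutation character counts fixed points**: `tr (g | k[X]) = #{x ∈ X : g • x = x}`.
[cite: SerreLinearRepresentations1977, §2.3 Ex. 2.2] -/
theorem trace_permRep [Finite X] (g : G) :
    LinearMap.trace k _ (permRep k G X g) = (Nat.card {x : X // g • x = x} : k) := by
  classical
  haveI : Fintype X := Fintype.ofFinite X
  rw [LinearMap.trace_eq_matrix_trace k Finsupp.basisSingleOne, Matrix.trace]
  simp only [Matrix.diag_apply, LinearMap.toMatrix_apply, Finsupp.coe_basisSingleOne,
    permRep_single, Finsupp.basisSingleOne_repr, LinearEquiv.refl_apply, Finsupp.single_apply]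
  rw [Finset.sum_boole, Nat.card_eq_fintype_card, Fintype.card_subtype]

end Augmentation

section AugmentationField

variable (k : Type*) [Field k] (G : Type*) [Group G] (X : Type*) [MulAction G X]

variable {G X} in
/-- **Character of the augmentation representation**: if `#X` is invertible in `k` then
`tr (g | ker ε) = #{x ∈ X : g • x = x} − 1` (`k[X] = 𝟙 ⊕ ker ε` and the permutation character
counts fixed points).  Proof: with `u = Σ_x e_x` and `π = id − (#X)⁻¹ · (ε ⊗ u)` (a projection of
`k[X]` onto `ker ε` commuting with `G`), `tr (g | ker ε) = tr (g ∘ π) = tr g − (#X)⁻¹ ε(u)`.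
[cite: SerreLinearRepresentations1977, §2.3 Ex. 2.2 and Ex. 2.6 (a)] -/
theorem trace_augmentationRep [Finite X] (hX : (Nat.card X : k) ≠ 0) (g : G) :
    LinearMap.trace k _ (augmentationRep k G X g) = (Nat.card {x : X // g • x = x} : k) - 1 := by
  classical
  haveI : Fintype X := Fintype.ofFinite X
  have hX' : (Fintype.card X : k) ≠ 0 := by rwa [Nat.card_eq_fintype_card] at hX
  let ε : (X →₀ k) →ₗ[k] k := augmentation k X
  let u : X →₀ k := ∑ x : X, Finsupp.single x 1
  have hεu : ε u = Fintype.card X := by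
    simp [u, ε, map_sum]
  have hgu : permRep k G X g u = u := by
    simp only [u, map_sum, permRep_single]
    exact Fintype.sum_equiv (MulAction.toPerm g) _ _ (fun x => rfl)
  let c : k := (Fintype.card X : k)⁻¹
  have hc : c * (Fintype.card X : k) = 1 := inv_mul_cancel₀ hX'
  let q : (X →₀ k) →ₗ[k] (X →₀ k) := c • ε.smulRight u
  have hq : ∀ f, q f = c • (ε f • u) := fun f => rfl
  let π : (X →₀ k) →ₗ[k] (X →₀ k) := LinearMap.id - q
  have hπ : ∀ f, π f = f - c • (ε f • u) := fun f => rfl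
  have hπ_mem : ∀ f, π f ∈ augmentationSubmodule k X := by
    intro f
    rw [mem_augmentationSubmodule_iff, hπ]
    change ε (f - c • (ε f • u)) = 0
    rw [map_sub, map_smul, map_smul, hεu, smul_eq_mul, smul_eq_mul, mul_left_comm, hc, mul_one,
      sub_self]
  have hπ_of_mem : ∀ f ∈ augmentationSubmodule k X, π f = f := by
    intro f hf
    rw [mem_augmentationSubmodule_iff] at hf
    rw [hπ, hf, zero_smul, smul_zero, sub_zero]
  have hmem : ∀ f, (permRep k G X g ∘ₗ π) f ∈ augmentationSubmodule k X :=
    fun f => permRep_mem_augmentationSubmodule k g (hπ_mem f)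
  have key := LinearMap.trace_restrict_eq_of_forall_mem (augmentationSubmodule k X)
    (permRep k G X g ∘ₗ π) hmem
  have hrestr : (permRep k G X g ∘ₗ π).restrict (fun f _ => hmem f) = augmentationRep k G X g := by
    refine LinearMap.ext fun f => Subtype.ext ?_
    simp only [LinearMap.coe_restrict_apply, LinearMap.comp_apply, coe_augmentationRep_apply]
    rw [hπ_of_mem f f.2]
  have hgq : permRep k G X g ∘ₗ q = q := by
    refine LinearMap.ext fun f => ?_
    simp only [LinearMap.comp_apply, hq, map_smul, hgu]
  rw [hrestr] at key
  have htq : LinearMap.trace k _ q = 1 := by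
    change LinearMap.trace k _ (c • ε.smulRight u) = 1
    rw [LinearMap.map_smul, LinearMap.trace_smulRight, hεu, smul_eq_mul, hc]
  have hsub : LinearMap.trace k _ (permRep k G X g ∘ₗ π) =
      LinearMap.trace k _ (permRep k G X g) - LinearMap.trace k _ q := by
    rw [LinearMap.comp_sub, LinearMap.comp_id, hgq]
    exact map_sub (LinearMap.trace k (X →₀ k)) _ _
  rw [key, hsub, trace_permRep, htq]

/-- `dim ker ε = #X − 1` for a nonempty finite `G`-set `X` (rank–nullity for the surjection `ε`).
[folklore] -/
theorem finrank_augmentationSubmodule [Finite X] [Nonempty X] :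
    Module.finrank k (augmentationSubmodule k X) = Nat.card X - 1 := by
  classical
  haveI : Fintype X := Fintype.ofFinite X
  have hrange : LinearMap.range (augmentation k X) = ⊤ := by
    refine LinearMap.range_eq_top.mpr fun c => ?_
    exact ⟨Finsupp.single (Classical.arbitrary X) c, augmentation_single k _ c⟩
  have h := LinearMap.finrank_range_add_finrank_ker (augmentation k X)
  rw [hrange, finrank_top, Module.finrank_self, Module.finrank_finsupp_self,
    ← Nat.card_eq_fintype_card] at h
  rw [augmentationSubmodule]
  omega

end AugmentationField

/-! ### Matrices of a representation in a basis -/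

section Frame

variable {k : Type*} [CommRing k] {G : Type*} [Group G] {W : Type*} [AddCommGroup W] [Module k W]
  {m : ℕ}

/-- The **matrix form** of a representation `τ` of a group `G` in a basis `b` indexed by `Fin m`:
`g ↦ [τ g]_b ∈ GL_m(k)`, with inverse `[τ g⁻¹]_b` (the algebraic part of `ContinuousRep.frame`).
[folklore] -/
def frameOfBasis (τ : Representation k G W) (b : Module.Basis (Fin m) k W) : G →* GL (Fin m) k where
  toFun g :=
    ⟨LinearMap.toMatrix b b (τ g), LinearMap.toMatrix b b (τ g⁻¹),
      by rw [← LinearMap.toMatrix_mul, ← map_mul, mul_inv_cancel, map_one, LinearMap.toMatrix_one],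
      by rw [← LinearMap.toMatrix_mul, ← map_mul, inv_mul_cancel, map_one, LinearMap.toMatrix_one]⟩
  map_one' := Units.ext <| by simp [LinearMap.toMatrix_one]
  map_mul' g h := Units.ext <| by simp [LinearMap.toMatrix_mul]

/-- Unfolding lemma for `frameOfBasis` (as a matrix). [folklore] -/
@[simp] lemma coe_frameOfBasis_apply (τ : Representation k G W) (b : Module.Basis (Fin m) k W)
    (g : G) : ((frameOfBasis τ b g : GL (Fin m) k) : Matrix (Fin m) (Fin m) k) =
      LinearMap.toMatrix b b (τ g) := rfl

/-- The matrix form has the trace of the representation. [folklore] -/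
lemma trace_frameOfBasis_apply (τ : Representation k G W) (b : Module.Basis (Fin m) k W) (g : G) :
    Matrix.trace ((frameOfBasis τ b g : GL (Fin m) k) : Matrix (Fin m) (Fin m) k) =
      LinearMap.trace k W (τ g) := by
  rw [coe_frameOfBasis_apply, ← LinearMap.trace_eq_matrix_trace]

end Frame

/-! ### Stable lines versus eigenvectors -/

section Eigenvectors

variable (K : Type*) [Field K] {n : Type*} [Fintype n] [DecidableEq n]

variable {K} in
/-- A line fixed by `g` consists of eigenvectors of `g`. [folklore] -/
lemma exists_mulVec_rep_eq_smul (g : GL n K) (L : ℙ K (n → K)) (hL : g • L = L) :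
    ∃ c : K, (g : Matrix n n K) *ᵥ L.rep = c • L.rep := by
  have h := hL
  rw [← L.mk_rep, Projectivization.smul_mk, Projectivization.mk_eq_mk_iff'] at h
  obtain ⟨c, hc⟩ := h
  exact ⟨c, hc.symm⟩

variable {K} in
/-- Auxiliary: `a • L.rep` is a non-zero eigenvector of `g` when `g • L = L` and `a ∈ Kˣ`.
[folklore] -/
lemma smul_rep_eigenvector (g : GL n K) (p : {L : ℙ K (n → K) // g • L = L} × Kˣ) :
    (p.2 : K) • p.1.1.rep ≠ 0 ∧
      ∃ a : K, (g : Matrix n n K) *ᵥ ((p.2 : K) • p.1.1.rep) = a • ((p.2 : K) • p.1.1.rep) := by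
  refine ⟨smul_ne_zero (Units.ne_zero p.2) p.1.1.rep_nonzero, ?_⟩
  obtain ⟨c, hc⟩ := exists_mulVec_rep_eq_smul g p.1.1 p.1.2
  exact ⟨c, by rw [Matrix.mulVec_smul, hc, smul_comm]⟩

/-- **Stable lines versus eigenvectors.** For `g ∈ GL_n(K)` over a field `K`, the non-zero
vectors `w` with `g w ∈ K w` are in bijection with pairs (line `L ∈ ℙ(Kⁿ)` with `g L = L`, unit
`a ∈ Kˣ`) via `(L, a) ↦ a • L.rep`; hence
`#{w ≠ 0 : ∃ a, g w = a w} = #{L : g L = L} · #Kˣ`. [folklore] -/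
theorem nat_card_eigenvectors_eq (g : GL n K) :
    Nat.card {w : n → K // w ≠ 0 ∧ ∃ a : K, (g : Matrix n n K) *ᵥ w = a • w} =
      Nat.card {L : ℙ K (n → K) // g • L = L} * Nat.card Kˣ := by
  rw [← Nat.card_prod]
  symm
  refine Nat.card_eq_of_bijective
    (fun p : {L : ℙ K (n → K) // g • L = L} × Kˣ =>
      (⟨(p.2 : K) • p.1.1.rep, smul_rep_eigenvector g p⟩ :
        {w : n → K // w ≠ 0 ∧ ∃ a : K, (g : Matrix n n K) *ᵥ w = a • w})) ⟨?_, ?_⟩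
  · rintro ⟨⟨L, hL⟩, a⟩ ⟨⟨L', hL'⟩, a'⟩ h
    simp only [Subtype.mk.injEq] at h
    have hLL' : L = L' := by
      rw [← L.mk_rep, ← L'.mk_rep, Projectivization.mk_eq_mk_iff]
      refine ⟨a⁻¹ * a', ?_⟩
      rw [mul_smul, Units.smul_def a', ← h, ← Units.smul_def, inv_smul_smul]
    subst hLL'
    have haa' : a = a' := Units.ext (smul_left_injective K L.rep_nonzero h)
    subst haa'
    rfl
  · rintro ⟨w, hw, a, ha⟩
    have hL : g • Projectivization.mk K w hw = Projectivization.mk K w hw := by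
      rw [Projectivization.smul_mk, Projectivization.mk_eq_mk_iff']
      exact ⟨a, ha.symm⟩
    obtain ⟨c, hc⟩ := Projectivization.exists_smul_eq_mk_rep K w hw
    refine ⟨(⟨Projectivization.mk K w hw, hL⟩, c⁻¹), Subtype.ext ?_⟩
    change ((c⁻¹ : Kˣ) : K) • (Projectivization.mk K w hw).rep = w
    rw [← hc, ← Units.smul_def, inv_smul_smul]

/-- `#{w ≠ 0 : ∃ a, g w = a w} = #{g-stable lines} · (#K − 1)` for a finite field `K`.
[folklore] -/
theorem nat_card_eigenvectors_eq' [Finite K] (g : GL n K) :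
    Nat.card {w : n → K // w ≠ 0 ∧ ∃ a : K, (g : Matrix n n K) *ᵥ w = a • w} =
      Nat.card {L : ℙ K (n → K) // g • L = L} * (Nat.card K - 1) := by
  rw [nat_card_eigenvectors_eq, Nat.card_units]

/-- `#ℙ¹(K) = #K + 1`. [folklore] -/
lemma nat_card_projectiveLine [Finite K] : Nat.card (ℙ K (Fin 2 → K)) = Nat.card K + 1 :=
  Projectivization.card_of_finrank_two K (Fin 2 → K) (Module.finrank_fin_fun K)

end Eigenvectors

/-! ### The Steinberg representation of `GL₂(𝔽_ℓ)` and the Steinberg–Artin representation -/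

section Steinberg

/-- The augmentation submodule of `ℂ[ℙ¹(K)]` has dimension `#K` (`= q`: the Steinberg
representation of `GL₂(𝔽_q)` is `q`-dimensional). [cite: FultonHarrisGTM129, §5.2 pp. 67–68] -/
theorem finrank_augmentationSubmodule_projectiveLine (K : Type*) [Field K] [Finite K] :
    Module.finrank ℂ (augmentationSubmodule ℂ (ℙ K (Fin 2 → K))) = Nat.card K := by
  haveI : Nonempty (ℙ K (Fin 2 → K)) := ⟨Projectivization.mk K (fun _ => 1) one_ne_zero⟩
  rw [finrank_augmentationSubmodule, nat_card_projectiveLine, Nat.add_sub_cancel]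

variable (ℓ : ℕ) [Fact ℓ.Prime]

/-- `dim_ℂ ker (ε : ℂ[ℙ¹(𝔽_ℓ)] → ℂ) = ℓ`. [cite: FultonHarrisGTM129, §5.2 pp. 67–68] -/
theorem finrank_augmentationSubmodule_projectiveLine_zmod :
    Module.finrank ℂ (augmentationSubmodule ℂ (ℙ (ZMod ℓ) (Fin 2 → ZMod ℓ))) = ℓ := by
  rw [finrank_augmentationSubmodule_projectiveLine, Nat.card_zmod]

/-- A basis, indexed by `Fin ℓ`, of the `ℓ`-dimensional augmentation submodule of `ℂ[ℙ¹(𝔽_ℓ)]`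
(chosen, `Module.finBasisOfFinrankEq`). [folklore] -/
def steinbergBasis : Module.Basis (Fin ℓ) ℂ (augmentationSubmodule ℂ (ℙ (ZMod ℓ) (Fin 2 → ZMod ℓ))) :=
  Module.finBasisOfFinrankEq ℂ _ (finrank_augmentationSubmodule_projectiveLine_zmod ℓ)

/-- The **Steinberg representation** `St_ℓ : GL₂(𝔽_ℓ) → GL_ℓ(ℂ)`: the representation of
`GL₂(𝔽_ℓ)` on the augmentation submodule `{Σ c_L e_L : Σ c_L = 0}` of the permutation module
`ℂ[ℙ¹(𝔽_ℓ)]` (so `ℂ[ℙ¹(𝔽_ℓ)] = 𝟙 ⊕ St_ℓ`), written in the basis `steinbergBasis ℓ`.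
[cite: FultonHarrisGTM129, §5.2 pp. 67–68] [cite: Bump1997, §4.1, Thm. 4.1.1 and sequel] -/
def steinbergGL : GL (Fin 2) (ZMod ℓ) →* GL (Fin ℓ) ℂ :=
  frameOfBasis (augmentationRep ℂ (GL (Fin 2) (ZMod ℓ)) (ℙ (ZMod ℓ) (Fin 2 → ZMod ℓ)))
    (steinbergBasis ℓ)

/-- Unfolding lemma: `St_ℓ(g)` is the matrix of `g` acting on the augmentation submodule of
`ℂ[ℙ¹(𝔽_ℓ)]` in the basis `steinbergBasis ℓ`. [folklore] -/
@[simp] lemma coe_steinbergGL_apply (g : GL (Fin 2) (ZMod ℓ)) :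
    ((steinbergGL ℓ g : GL (Fin ℓ) ℂ) : Matrix (Fin ℓ) (Fin ℓ) ℂ) =
      LinearMap.toMatrix (steinbergBasis ℓ) (steinbergBasis ℓ)
        (augmentationRep ℂ (GL (Fin 2) (ZMod ℓ)) (ℙ (ZMod ℓ) (Fin 2 → ZMod ℓ)) g) := rfl

/-- **The Steinberg character**: `tr St_ℓ(g) = #{g-stable lines in 𝔽_ℓ²} − 1`
(`= ℓ, 0, 1, −1` on central, non-semisimple, split and non-split semisimple classes).
[cite: FultonHarrisGTM129, §5.2 pp. 67–68] -/
theorem trace_steinbergGL (g : GL (Fin 2) (ZMod ℓ)) :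
    Matrix.trace ((steinbergGL ℓ g : GL (Fin ℓ) ℂ) : Matrix (Fin ℓ) (Fin ℓ) ℂ) =
      (Nat.card {L : ℙ (ZMod ℓ) (Fin 2 → ZMod ℓ) // g • L = L} : ℂ) - 1 := by
  rw [steinbergGL, trace_frameOfBasis_apply, trace_augmentationRep]
  rw [nat_card_projectiveLine]
  exact Nat.cast_ne_zero.mpr (Nat.succ_ne_zero _)

/-- The Steinberg character in terms of eigenvectors:
`tr St_ℓ(g) = #{w ≠ 0 in 𝔽_ℓ² : ∃ a, g w = a w} / (ℓ − 1) − 1`. [folklore] -/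
theorem trace_steinbergGL_eq_card_eigenvectors (g : GL (Fin 2) (ZMod ℓ)) :
    Matrix.trace ((steinbergGL ℓ g : GL (Fin ℓ) ℂ) : Matrix (Fin ℓ) (Fin ℓ) ℂ) =
      ((Nat.card {w : Fin 2 → ZMod ℓ // w ≠ 0 ∧ ∃ a : ZMod ℓ,
          (g : Matrix (Fin 2) (Fin 2) (ZMod ℓ)).mulVec w = a • w} : ℂ)) / ((ℓ : ℂ) - 1) - 1 := by
  have hℓ : ((ℓ : ℂ) - 1) ≠ 0 :=
    sub_ne_zero.mpr (by exact_mod_cast (Fact.out : ℓ.Prime).one_lt.ne')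
  rw [trace_steinbergGL, nat_card_eigenvectors_eq', Nat.card_zmod, Nat.cast_mul,
    Nat.cast_sub (Fact.out : ℓ.Prime).one_lt.le, Nat.cast_one, mul_div_cancel_right₀ _ hℓ]

variable {Γ : Type*} [Group Γ] [TopologicalSpace Γ]

/-- **`St_ℓ ∘ ρ`.** The composite of a continuous representation `ρ : Γ → GL₂(𝔽_ℓ)` with the
Steinberg representation `St_ℓ : GL₂(𝔽_ℓ) → GL_ℓ(ℂ)`; continuous because `GL₂(𝔽_ℓ)` is
discrete. [cite: FultonHarrisGTM129, §5.2 pp. 67–68] -/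
def FramedRep.steinberg (ρ : FramedRep Γ (ZMod ℓ) 2) : FramedRep Γ ℂ ℓ where
  toMonoidHom := (steinbergGL ℓ).comp ρ.toMonoidHom
  continuous_toFun :=
    show Continuous fun γ => steinbergGL ℓ (ρ γ) from
      continuous_of_discreteTopology.comp (map_continuous ρ)

/-- Unfolding lemma for `FramedRep.steinberg`. [folklore] -/
@[simp] lemma FramedRep.steinberg_apply (ρ : FramedRep Γ (ZMod ℓ) 2) (γ : Γ) :
    ρ.steinberg ℓ γ = steinbergGL ℓ (ρ γ) := rfl

/-- The character of `St_ℓ ∘ ρ`: `tr (St_ℓ ∘ ρ)(γ) = #{w ≠ 0 : ∃ a, ρ(γ) w = a w}/(ℓ − 1) − 1`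
(`= #{ρ(γ)-stable lines} − 1`). [cite: FultonHarrisGTM129, §5.2 pp. 67–68] -/
theorem FramedRep.steinberg_trace (ρ : FramedRep Γ (ZMod ℓ) 2) (γ : Γ) :
    ((ρ.steinberg ℓ γ : GL (Fin ℓ) ℂ) : Matrix (Fin ℓ) (Fin ℓ) ℂ).trace =
      ((Nat.card {w : Fin 2 → ZMod ℓ // w ≠ 0 ∧ ∃ a : ZMod ℓ,
          ((ρ γ : GL (Fin 2) (ZMod ℓ)) : Matrix (Fin 2) (Fin 2) (ZMod ℓ)).mulVec w = a • w} : ℂ)) /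
        ((ℓ : ℂ) - 1) - 1 :=
  trace_steinbergGL_eq_card_eigenvectors ℓ (ρ γ)

variable {K : Type u} [Field K]

/-- **The Steinberg–Artin representation** `St_ℓ ∘ ρ̄ : Γ_K → GL_ℓ(ℂ)` attached to a continuous
mod-`ℓ` Galois representation `ρ̄ : Γ_K → GL₂(𝔽_ℓ)`: `Γ_K` acts through `ρ̄` on the augmentation
submodule of `ℂ[ℙ¹(𝔽_ℓ)]` (dimension `ℓ`), in the chosen basis `steinbergBasis ℓ`; an Artin
representation (finite image) with the Steinberg character `#{ρ̄(γ)-stable lines} − 1`.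
[cite: FultonHarrisGTM129, §5.2 pp. 67–68] [cite: Bump1997, §4.1, Thm. 4.1.1 and sequel] -/
def steinbergArtinRep (ρ : FramedGaloisRep K (ZMod ℓ) 2) : FramedGaloisRep K ℂ ℓ :=
  FramedRep.steinberg ℓ ρ

/-- `steinbergArtinRep` is `FramedRep.steinberg` for `Γ = Γ_K`. [folklore] -/
lemma steinbergArtinRep_eq (ρ : FramedGaloisRep K (ZMod ℓ) 2) :
    steinbergArtinRep ℓ ρ = FramedRep.steinberg ℓ ρ := rfl

/-- Unfolding lemma for `steinbergArtinRep`: `(St_ℓ ∘ ρ̄)(γ) = St_ℓ(ρ̄ γ)`. [folklore] -/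
@[simp] lemma steinbergArtinRep_apply (ρ : FramedGaloisRep K (ZMod ℓ) 2) (γ : Field.absoluteGaloisGroup K) :
    steinbergArtinRep ℓ ρ γ = steinbergGL ℓ (ρ γ) := rfl

/-- **The Steinberg character of `St_ℓ ∘ ρ̄`** in the form used by route `SteinbergArtin`
(`SteinbergArtinExists`, hypothesis of `SteinbergStrongArtin`):
`tr (St_ℓ ∘ ρ̄)(γ) = #{w ≠ 0 in 𝔽_ℓ² : ∃ a, ρ̄(γ) w = a w} / (ℓ − 1) − 1`.
[cite: FultonHarrisGTM129, §5.2 pp. 67–68] -/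
theorem steinbergArtinRep_trace (ρ : FramedGaloisRep K (ZMod ℓ) 2)
    (γ : Field.absoluteGaloisGroup K) :
    ((steinbergArtinRep ℓ ρ γ : GL (Fin ℓ) ℂ) : Matrix (Fin ℓ) (Fin ℓ) ℂ).trace =
      ((Nat.card {w : Fin 2 → ZMod ℓ // w ≠ 0 ∧ ∃ a : ZMod ℓ,
          ((ρ γ : GL (Fin 2) (ZMod ℓ)) : Matrix (Fin 2) (Fin 2) (ZMod ℓ)).mulVec w = a • w} : ℂ)) /
        ((ℓ : ℂ) - 1) - 1 :=
  FramedRep.steinberg_trace ℓ ρ γ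

/-- The Steinberg character also reads `tr (St_ℓ ∘ ρ̄)(γ) = #{ρ̄(γ)-stable lines} − 1`.
[cite: FultonHarrisGTM129, §5.2 pp. 67–68] -/
theorem steinbergArtinRep_trace_eq_card_stableLines (ρ : FramedGaloisRep K (ZMod ℓ) 2)
    (γ : Field.absoluteGaloisGroup K) :
    ((steinbergArtinRep ℓ ρ γ : GL (Fin ℓ) ℂ) : Matrix (Fin ℓ) (Fin ℓ) ℂ).trace =
      (Nat.card {L : ℙ (ZMod ℓ) (Fin 2 → ZMod ℓ) // ρ γ • L = L} : ℂ) - 1 :=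
  trace_steinbergGL ℓ (ρ γ)

/-- **Existence of the Steinberg–Artin representation** (the statement of route item
`SteinbergArtinExists`, for any base field `K`): every continuous `ρ̄ : Γ_K → GL₂(𝔽_ℓ)` admits a
continuous `σ : Γ_K → GL_ℓ(ℂ)` with the Steinberg character of `ρ̄`, namely
`σ = steinbergArtinRep ℓ ρ̄`. [cite: FultonHarrisGTM129, §5.2 pp. 67–68] -/
theorem steinbergArtin_exists (ρ : FramedGaloisRep K (ZMod ℓ) 2) :
    ∃ σ : FramedGaloisRep K ℂ ℓ, ∀ g,
      ((σ g : Matrix (Fin ℓ) (Fin ℓ) ℂ)).trace =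
        ((Nat.card {w : Fin 2 → ZMod ℓ // w ≠ 0 ∧ ∃ a : ZMod ℓ,
            ((ρ g : Matrix (Fin 2) (Fin 2) (ZMod ℓ))).mulVec w = a • w} : ℂ)) /
          ((ℓ : ℂ) - 1) - 1 :=
  ⟨steinbergArtinRep ℓ ρ, steinbergArtinRep_trace ℓ ρ⟩

end Steinberg

end Literature.NumberTheory.GaloisRepresentations
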